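import Literature.Computability.MetaComplexity.TextbookFregeCompleteness
import HarnessLib

/-!
# Size- and depth-bounded derivations in the textbook Frege system

Support layer for bounded-depth Frege *upper-bound* constructions (used by the discharge of
`Literature.Computability.MetaComplexity.krajicek_ramseyCritical_depthFrege_lowerBound`, Krajíček
2010, Thm. 1.1, whose proof builds constant-depth polynomial-size Frege derivations). The derived
rules of `TextbookFregeCompleteness.lean` (`TextbookFrege.comm`, `assoc'`, `consConj`, …) only
assert derivability (`FregeSystem.Derives`); here every rule comes with an account of

* the NUMBER OF LINES of the derivation,
* a uniform bound `B` on the SIZE (`PropForm.size`) of every line, and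
* a uniform bound `D` on the DISJUNCT DEPTH `PropForm.dd ψ = altDepthAux 3 ψ` of every line
  (so every line has alternation depth `≤ D + 1`, `PropForm.altDepth_le_dd_succ`).

`TextbookFrege.BD D B ℓ φ` says: there is a `textbookFrege`-derivation (from no hypotheses) of
`φ` with at most `ℓ` lines, all of disjunct depth `≤ D` and size `≤ B`; hence
(`TextbookFrege.BD.exists_isDepthProofOf`) a depth-`(D+1)` proof of `φ` of `proofSize ≤ ℓ·B`.
The disjunct depth is the right invariant because the system manipulates right-nested
disjunctions: `dd (a ∨ b) = max (dd a) (dd b)`, so purely structural steps never raise it, and a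
negation or conjunction on top of pieces of depth `≤ p` costs at most `2`.

Contents. (1) `dd` and its calculus. (2) `BD` with the nine rule schemes of `textbookFrege`
in bounded form (`axB`, `expanB`, `contrB`, `assocB`, `cutB`, `conjAx₁B`, `conjAx₂B`, `topB`,
`negBotB`) and Hodel's derived rules in bounded form (`commB`, `expan'B`, `assoc'B`, `negNegB`,
`genExpB`, `genCtnB`, `removeBotB`, `mpB`). (3) Sequent-style rules, reading
`TextbookFrege.disjList L = A₁ ∨ (A₂ ∨ ⋯ (Aₙ ∨ ⊥))` as the one-sided sequent `⊢ A₁, …, Aₙ`: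
`axS`, `memberIntroB` (`⊢ ¬A ∨ ⋁L` for `A ∈ L`), `subsetB` (weakening + exchange + contraction,
implemented by cuts against `memberIntroB`), `cutS`, the connective rules `consDisjS`, `flattenS`,
`consNegNegS`, `consNegDisjS`, `consConjS`, `consNegConjS` of Shoenfield's tautology theorem (as
in `TextbookFregeCompleteness.lean`), and the iterated rules `elimAllS` (cut away a list of head
formulas), `negDisjListS` (`⊢ ¬⋁Z, L`), `conjExtractS` (`⊢ ¬⋀M, A` for `A ∈ M`, with
`conjList`), `productS` (distributivity). Depth hypotheses are phrased through bounds on the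
disjunct depth of the pieces plus a rule-specific constant `≤ 8`; size hypotheses are linear in
the pieces (`msum L = Σ (|A|+1)` makes them additive). The side conditions are closed uniformly
by `norm_num only [size, dd_disj, …]; omega`.

What is NOT here: cut-elimination or any lower bound; p-simulations; the extension rule.

Sources: J. R. Shoenfield, *Mathematical Logic* (1967), §2.6, §3.1; R. E. Hodel, *An Introduction
to Mathematical Logic* (1995), Ch. 3 (the derived rules, followed line by line as in
`TextbookFregeCompleteness.lean`); J. Krajíček, *Bounded arithmetic, propositional logic, and
complexity theory* (1995), §4.3 (depth), §4.4 (size of Frege proofs). The bookkeeping itself is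
folklore ("each derived rule is a constant number of lines of linear size").
-/

namespace Literature.Computability.Complexity.PropForm

/-! ### Disjunct depth -/

universe u

variable {ν : Type u}

/-- The *disjunct depth* of a formula: its alternation depth when it stands directly below a
disjunction (`altDepthAux 3`). For a right-nested disjunction this is the maximum over the
disjuncts, which makes it the natural invariant of Shoenfield-style derivations.
[Krajíček 1995, §4.3 (depth)] [folklore] -/
def dd (φ : PropForm ν) : ℕ :=
  altDepthAux 3 φ

/-- Variables have disjunct depth `0`. [folklore] -/
@[simp] theorem dd_var (x : ν) : dd (var x) = 0 := by simp [dd, altDepthAux]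

/-- Constants have disjunct depth `0`. [folklore] -/
@[simp] theorem dd_const (b : Bool) : dd (const b : PropForm ν) = 0 := by simp [dd, altDepthAux]

/-- Disjunct depth of a disjunction is the maximum of the disjuncts'. [folklore] -/
@[simp] theorem dd_disj (a b : PropForm ν) : dd (disj a b) = max (dd a) (dd b) := by
  simp [dd, altDepthAux]

/-- Disjunct depth of a negation. [folklore] -/
@[simp] theorem dd_neg (a : PropForm ν) : dd (neg a) = altDepthAux 1 a + 1 := by
  simp [dd, altDepthAux]

/-- Disjunct depth of a conjunction. [folklore] -/
@[simp] theorem dd_conj (a b : PropForm ν) :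
    dd (conj a b) = max (altDepthAux 2 a) (altDepthAux 2 b) + 1 := by
  simp [dd, altDepthAux]

/-- Auxiliary depth of a variable. [folklore] -/
@[simp] theorem altDepthAux_var' (c : ℕ) (x : ν) : altDepthAux c (var x) = 0 := by
  simp [altDepthAux]

/-- Auxiliary depth of a constant. [folklore] -/
@[simp] theorem altDepthAux_const' (c : ℕ) (b : Bool) : altDepthAux c (const b : PropForm ν) = 0 := by
  simp [altDepthAux]

/-- Nested negations form one block. [folklore] -/
@[simp] theorem altDepthAux_one_neg (a : PropForm ν) : altDepthAux 1 (neg a) = altDepthAux 1 a := by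
  simp [altDepthAux]

/-- A negation below a conjunction opens a block. [folklore] -/
@[simp] theorem altDepthAux_two_neg (a : PropForm ν) :
    altDepthAux 2 (neg a) = altDepthAux 1 a + 1 := by
  simp [altDepthAux]

/-- A disjunction below a negation opens a block. [folklore] -/
@[simp] theorem altDepthAux_one_disj (a b : PropForm ν) :
    altDepthAux 1 (disj a b) = max (dd a) (dd b) + 1 := by
  simp [dd, altDepthAux]

/-- A disjunction below a conjunction opens a block. [folklore] -/
@[simp] theorem altDepthAux_two_disj (a b : PropForm ν) :
    altDepthAux 2 (disj a b) = max (dd a) (dd b) + 1 := by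
  simp [dd, altDepthAux]

/-- A conjunction below a negation opens a block. [folklore] -/
@[simp] theorem altDepthAux_one_conj (a b : PropForm ν) :
    altDepthAux 1 (conj a b) = max (altDepthAux 2 a) (altDepthAux 2 b) + 1 := by
  simp [altDepthAux]

/-- Nested conjunctions form one block. [folklore] -/
@[simp] theorem altDepthAux_two_conj (a b : PropForm ν) :
    altDepthAux 2 (conj a b) = max (altDepthAux 2 a) (altDepthAux 2 b) := by
  simp [altDepthAux]

/-- The auxiliary depths for different parents differ by at most one. [folklore] -/
theorem altDepthAux_le_altDepthAux_succ (c c' : ℕ) (φ : PropForm ν) :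
    altDepthAux c φ ≤ altDepthAux c' φ + 1 := by
  cases φ <;> simp only [altDepthAux] <;> (try split_ifs) <;> omega

/-- Any auxiliary depth is at most the disjunct depth plus one. [folklore] -/
theorem altDepthAux_le_dd_succ (c : ℕ) (φ : PropForm ν) : altDepthAux c φ ≤ dd φ + 1 :=
  altDepthAux_le_altDepthAux_succ c 3 φ

/-- The alternation depth is at most the disjunct depth plus one. [folklore] -/
theorem altDepth_le_dd_succ (φ : PropForm ν) : altDepth φ ≤ dd φ + 1 :=
  altDepthAux_le_altDepthAux_succ 0 3 φ

/-- Auxiliary depths are at most the alternation depth. [folklore] -/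
theorem altDepthAux_le_altDepth' (c : ℕ) (φ : PropForm ν) : altDepthAux c φ ≤ altDepth φ := by
  cases φ with
  | var _ => simp [altDepth, altDepthAux]
  | const _ => simp [altDepth, altDepthAux]
  | neg φ =>
    simp only [altDepth, altDepthAux, show (0 : ℕ) ≠ 1 by decide, if_false]
    split_ifs <;> omega
  | conj φ ψ =>
    simp only [altDepth, altDepthAux, show (0 : ℕ) ≠ 2 by decide, if_false]
    split_ifs <;> omega
  | disj φ ψ =>
    simp only [altDepth, altDepthAux, show (0 : ℕ) ≠ 3 by decide, if_false]
    split_ifs <;> omega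

/-- A formula is no deeper, as a disjunct, than its negation. [folklore] -/
theorem dd_le_dd_neg (φ : PropForm ν) : dd φ ≤ dd (neg φ) := by
  rw [dd_neg]; exact altDepthAux_le_altDepthAux_succ 3 1 φ

/-- The disjunct depth is at most the alternation depth. [folklore] -/
theorem dd_le_altDepth (φ : PropForm ν) : dd φ ≤ altDepth φ :=
  altDepthAux_le_altDepth' 3 φ

end Literature.Computability.Complexity.PropForm

namespace Literature.Computability.MetaComplexity

open Complexity Complexity.PropForm

namespace TextbookFrege

/-! ### Bounded derivations -/

/-- A line is admissible for the bounds `(D, B)`: disjunct depth `≤ D` and size `≤ B`. [folklore] -/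
def LineOK (D B : ℕ) (ψ : PropForm ℕ) : Prop :=
  ψ.dd ≤ D ∧ ψ.size ≤ B

/-- `BD D B ℓ φ`: `φ` has a `textbookFrege`-derivation from no hypotheses with at most `ℓ` lines,
every line of disjunct depth `≤ D` and size `≤ B`. [Krajíček 1995, §4.3–4.4 (depth and size of
Frege proofs)] [folklore] -/
def BD (D B ℓ : ℕ) (φ : PropForm ℕ) : Prop :=
  ∃ π : List (PropForm ℕ), textbookFrege.IsDerivation ∅ π ∧ π.getLast? = some φ ∧
    π.length ≤ ℓ ∧ ∀ ψ ∈ π, LineOK D B ψ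

variable {D B : ℕ}

namespace BD

variable {ℓ ℓ' ℓ₁ ℓ₂ : ℕ} {φ : PropForm ℕ}

/-- More lines allowed. [folklore] -/
theorem mono (h : BD D B ℓ φ) (hℓ : ℓ ≤ ℓ') : BD D B ℓ' φ := by
  obtain ⟨π, hπ, hlast, hlen, hok⟩ := h
  exact ⟨π, hπ, hlast, hlen.trans hℓ, hok⟩

/-- Weaker line bounds allowed. [folklore] -/
theorem weaken {D' B' : ℕ} (h : BD D B ℓ φ) (hD : D ≤ D') (hB : B ≤ B') : BD D' B' ℓ φ := by
  obtain ⟨π, hπ, hlast, hlen, hok⟩ := h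
  exact ⟨π, hπ, hlast, hlen, fun ψ hψ => ⟨(hok ψ hψ).1.trans hD, (hok ψ hψ).2.trans hB⟩⟩

/-- The conclusion is an admissible line. [folklore] -/
theorem lineOK (h : BD D B ℓ φ) : LineOK D B φ := by
  obtain ⟨π, _, hlast, _, hok⟩ := h
  exact hok φ (List.mem_of_getLast? hlast)

/-- A bounded derivation has at least one line. [folklore] -/
theorem one_le (h : BD D B ℓ φ) : 1 ≤ ℓ := by
  obtain ⟨π, _, hlast, hlen, _⟩ := h
  cases π with
  | nil => simp at hlast
  | cons _ _ => exact le_trans (by simp) hlen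

/-- **From bounded derivations to bounded-depth proofs**: a `BD D B ℓ`-derivation of `φ` is a
depth-`(D+1)` `textbookFrege`-proof of `φ` of size at most `ℓ · B`.
[Krajíček 1995, §4.3–4.4] [folklore] -/
theorem exists_isDepthProofOf (h : BD D B ℓ φ) :
    ∃ π, textbookFrege.IsDepthProofOf (D + 1) π φ ∧ proofSize π ≤ ℓ * B := by
  obtain ⟨π, hπ, hlast, hlen, hok⟩ := h
  refine ⟨π, ⟨⟨hπ, hlast⟩, fun ψ hψ => (altDepth_le_dd_succ ψ).trans (by have := (hok ψ hψ).1; omega)⟩, ?_⟩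
  unfold proofSize
  calc (π.map PropForm.size).sum ≤ (π.map fun _ => B).sum :=
        List.sum_le_sum (fun ψ hψ => (hok ψ hψ).2)
    _ = π.length * B := by simp [List.sum_replicate]
    _ ≤ ℓ * B := Nat.mul_le_mul_right _ hlen

end BD

/-! ### Rule application with bookkeeping -/

/-- Appending an inferred line to a derivation gives a derivation. [Cook–Reckhow 1979, §2]
[folklore] -/
theorem isDerivation_append_of_isInferred {π : List (PropForm ℕ)} {θ : PropForm ℕ}
    (hπ : textbookFrege.IsDerivation ∅ π) (hθ : textbookFrege.IsInferred π θ) :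
    textbookFrege.IsDerivation ∅ (π ++ [θ]) := by
  intro k hk
  rw [List.length_append, List.length_singleton] at hk
  by_cases hk' : k < π.length
  · rw [List.getElem_append_left hk', List.take_append_of_le_length hk'.le]
    exact hπ k hk'
  · have hkeq : k = π.length := by omega
    have htake : (π ++ [θ]).take k = π := by
      rw [List.take_append_of_le_length (by omega), hkeq, List.take_length]
    rw [List.getElem_concat_length hkeq, htake]
    exact Or.inr hθ

/-- Bounded application of an axiom scheme of `textbookFrege`. [folklore] -/
theorem BD.rule0 {c : PropForm ℕ} (hr : (⟨[], c⟩ : FregeRule) ∈ textbookFrege.rules)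
    (σ : ℕ → PropForm ℕ) (hl : LineOK D B (c.subst σ)) : BD D B 1 (c.subst σ) := by
  refine ⟨[c.subst σ], ?_, rfl, le_rfl, fun ψ hψ => ?_⟩
  · have h := isDerivation_append_of_isInferred (FregeSystem.isDerivation_nil textbookFrege ∅)
      (θ := c.subst σ) ⟨_, hr, σ, rfl, fun p hp => by simp at hp⟩
    simpa using h
  · rw [List.mem_singleton] at hψ
    exact hψ ▸ hl

/-- Bounded application of a one-premise rule scheme of `textbookFrege`. [folklore] -/
theorem BD.rule1 {ℓ : ℕ} {p c : PropForm ℕ} (hr : (⟨[p], c⟩ : FregeRule) ∈ textbookFrege.rules)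
    (σ : ℕ → PropForm ℕ) (h : BD D B ℓ (p.subst σ)) (hl : LineOK D B (c.subst σ)) :
    BD D B (ℓ + 1) (c.subst σ) := by
  obtain ⟨π, hπ, hlast, hlen, hok⟩ := h
  refine ⟨π ++ [c.subst σ], isDerivation_append_of_isInferred hπ
    ⟨_, hr, σ, rfl, fun q hq => ?_⟩, by simp, by simpa using hlen, fun ψ hψ => ?_⟩
  · rw [List.mem_singleton] at hq
    exact hq ▸ List.mem_of_getLast? hlast
  · rw [List.mem_append, List.mem_singleton] at hψ
    rcases hψ with hψ | rfl
    · exact hok ψ hψ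
    · exact hl

/-- Bounded application of a two-premise rule scheme of `textbookFrege`. [folklore] -/
theorem BD.rule2 {ℓ₁ ℓ₂ : ℕ} {p₁ p₂ c : PropForm ℕ}
    (hr : (⟨[p₁, p₂], c⟩ : FregeRule) ∈ textbookFrege.rules) (σ : ℕ → PropForm ℕ)
    (h₁ : BD D B ℓ₁ (p₁.subst σ)) (h₂ : BD D B ℓ₂ (p₂.subst σ)) (hl : LineOK D B (c.subst σ)) :
    BD D B (ℓ₁ + ℓ₂ + 1) (c.subst σ) := by
  obtain ⟨π₁, hπ₁, hlast₁, hlen₁, hok₁⟩ := h₁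
  obtain ⟨π₂, hπ₂, hlast₂, hlen₂, hok₂⟩ := h₂
  refine ⟨π₁ ++ π₂ ++ [c.subst σ], isDerivation_append_of_isInferred (hπ₁.append hπ₂)
    ⟨_, hr, σ, rfl, fun q hq => ?_⟩, by simp, ?_, fun ψ hψ => ?_⟩
  · simp only [List.mem_cons, List.not_mem_nil, or_false] at hq
    rcases hq with rfl | rfl
    · exact List.mem_append_left _ (List.mem_of_getLast? hlast₁)
    · exact List.mem_append_right _ (List.mem_of_getLast? hlast₂)
  · simp only [List.length_append, List.length_singleton]; omega
  · simp only [List.mem_append, List.mem_singleton] at hψ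
    rcases hψ with (hψ | hψ) | rfl
    · exact hok₁ ψ hψ
    · exact hok₂ ψ hψ
    · exact hl

/-! ### The nine rule schemes, bounded -/

variable {ℓ ℓ₁ ℓ₂ : ℕ} {a b c d : PropForm ℕ}

/-- Bounded propositional axiom `¬A ∨ A`. [Shoenfield 1967, §2.6] [folklore] -/
theorem axB (a : PropForm ℕ) (hl : LineOK D B (disj (neg a) a)) : BD D B 1 (disj (neg a) a) :=
  BD.rule0 (c := disj (neg (var 0)) (var 0)) (by simp [textbookFrege]) (sub3 a a a) hl

/-- Bounded expansion `A ⊢ B ∨ A`. [Shoenfield 1967, §2.6] [folklore] -/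
theorem expanB (b : PropForm ℕ) (h : BD D B ℓ a) (hl : LineOK D B (disj b a)) :
    BD D B (ℓ + 1) (disj b a) :=
  BD.rule1 (p := var 0) (c := disj (var 1) (var 0)) (by simp [textbookFrege]) (sub3 a b b) h hl

/-- Bounded contraction `A ∨ A ⊢ A` (the new line is smaller and no deeper). [Shoenfield 1967,
§2.6] [folklore] -/
theorem contrB (h : BD D B ℓ (disj a a)) : BD D B (ℓ + 1) a := by
  have hl := h.lineOK
  have hl' : LineOK D B a := by
    simp only [LineOK, dd_disj, size] at hl ⊢; omega
  exact BD.rule1 (p := disj (var 0) (var 0)) (c := var 0) (by simp [textbookFrege]) (sub3 a a a) h hl'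

/-- Bounded associativity `A ∨ (B ∨ C) ⊢ (A ∨ B) ∨ C` (same size and depth). [Shoenfield 1967,
§2.6] [folklore] -/
theorem assocB (h : BD D B ℓ (disj a (disj b c))) : BD D B (ℓ + 1) (disj (disj a b) c) := by
  have hl := h.lineOK
  have hl' : LineOK D B (disj (disj a b) c) := by
    simp only [LineOK, dd_disj, size] at hl ⊢; omega
  exact BD.rule1 (p := disj (var 0) (disj (var 1) (var 2)))
    (c := disj (disj (var 0) (var 1)) (var 2)) (by simp [textbookFrege]) (sub3 a b c) h hl'

/-- Bounded cut `A ∨ B, ¬A ∨ C ⊢ B ∨ C`; the conclusion is no deeper than the premises but its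
size must be checked. [Shoenfield 1967, §2.6] [folklore] -/
theorem cutB (h₁ : BD D B ℓ₁ (disj a b)) (h₂ : BD D B ℓ₂ (disj (neg a) c))
    (hs : b.size + c.size + 1 ≤ B) : BD D B (ℓ₁ + ℓ₂ + 1) (disj b c) := by
  have hl₁ := h₁.lineOK
  have hl₂ := h₂.lineOK
  have hl' : LineOK D B (disj b c) := by
    simp only [LineOK, dd_disj, dd_neg, size] at hl₁ hl₂ ⊢; omega
  exact BD.rule2 (p₁ := disj (var 0) (var 1)) (p₂ := disj (neg (var 0)) (var 2))
    (c := disj (var 1) (var 2)) (by simp [textbookFrege]) (sub3 a b c) h₁ h₂ hl'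

/-- Bounded first definitional axiom for `∧`: `⊢ ¬(A ∧ B) ∨ ¬(¬A ∨ ¬B)`. [Hodel 1995, p. 100]
[folklore] -/
theorem conjAx₁B (a b : PropForm ℕ)
    (hl : LineOK D B (disj (neg (conj a b)) (neg (disj (neg a) (neg b))))) :
    BD D B 1 (disj (neg (conj a b)) (neg (disj (neg a) (neg b)))) :=
  BD.rule0 (c := disj (neg (conj (var 0) (var 1))) (neg (disj (neg (var 0)) (neg (var 1)))))
    (by simp [textbookFrege]) (sub3 a b b) hl

/-- Bounded second definitional axiom for `∧`: `⊢ ¬¬(¬A ∨ ¬B) ∨ (A ∧ B)`. [Hodel 1995, p. 100]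
[folklore] -/
theorem conjAx₂B (a b : PropForm ℕ)
    (hl : LineOK D B (disj (neg (neg (disj (neg a) (neg b)))) (conj a b))) :
    BD D B 1 (disj (neg (neg (disj (neg a) (neg b)))) (conj a b)) :=
  BD.rule0 (c := disj (neg (neg (disj (neg (var 0)) (neg (var 1))))) (conj (var 0) (var 1)))
    (by simp [textbookFrege]) (sub3 a b b) hl

/-- Bounded axiom `⊢ ⊤`. [Buss 1998, §1.1] [folklore] -/
theorem topB (hB : 1 ≤ B) : BD D B 1 (const true) :=
  have hl : LineOK D B (const true) := ⟨by simp, by simpa [size] using hB⟩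
  BD.rule0 (c := const true) (by simp [textbookFrege]) (sub3 (const true) (const true) (const true)) hl

/-- Bounded axiom `⊢ ¬⊥`. [Buss 1998, §1.1] [folklore] -/
theorem negBotB (hD : 1 ≤ D) (hB : 2 ≤ B) : BD D B 1 (neg (const false)) :=
  have hl : LineOK D B (neg (const false)) := ⟨by simpa using hD, by simpa [size] using hB⟩
  BD.rule0 (c := neg (const false)) (by simp [textbookFrege])
    (sub3 (const true) (const true) (const true)) hl

/-! ### Hodel's derived rules, bounded

Depth hypotheses: `(neg x).dd ≤ D` says that the schematic piece `x` may be negated on a line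
(the axiom `¬x ∨ x` of a commutation step); `x.dd + 2 ≤ D` says the same for a disjunction having
`x` as a disjunct. Size hypotheses are linear in the pieces. Line counts are exact. -/

/-- Bounded commutation `A ∨ B ⊢ B ∨ A` (cut with the axiom; 2 more lines).
[Hodel 1995, p. 101 (CM)] [folklore] -/
theorem commB (h : BD D B ℓ (disj a b)) (ha : (neg a).dd ≤ D) (hs : 2 * a.size + 2 ≤ B) :
    BD D B (ℓ + 2) (disj b a) := by
  have hl := h.lineOK
  simp only [LineOK, dd_disj, size] at hl
  rw [dd_neg] at ha
  refine cutB h (axB a ⟨?_, ?_⟩) (by omega)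
  · simp only [dd_disj, dd_neg]; omega
  · simp only [size]; omega

/-- Bounded new expansion `A ⊢ A ∨ B` (3 more lines). [Hodel 1995, p. 102] [folklore] -/
theorem expan'B (b : PropForm ℕ) (h : BD D B ℓ a) (hb : (neg b).dd ≤ D)
    (hs₁ : a.size + b.size + 1 ≤ B) (hs₂ : 2 * b.size + 2 ≤ B) : BD D B (ℓ + 3) (disj a b) := by
  have hl := h.lineOK
  simp only [LineOK] at hl
  have hb' := dd_le_dd_neg b
  refine commB (expanB b h ⟨?_, ?_⟩) hb hs₂
  · simp only [dd_disj]; omega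
  · simp only [size]; omega

/-- Bounded new associativity `(A ∨ B) ∨ C ⊢ A ∨ (B ∨ C)` (8 more lines).
[Hodel 1995, p. 102] [folklore] -/
theorem assoc'B (h : BD D B ℓ (disj (disj a b) c)) (ha : a.dd + 2 ≤ D) (hb : b.dd + 2 ≤ D)
    (hc : c.dd + 2 ≤ D) (hs : 2 * (a.size + b.size + c.size) + 4 ≤ B) :
    BD D B (ℓ + 8) (disj a (disj b c)) := by
  have hl := h.lineOK
  simp only [LineOK, dd_disj, size] at hl
  refine commB (assocB (commB (assocB (commB h ?_ ?_)) ?_ ?_)) ?_ ?_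
  · simp only [dd_neg, altDepthAux_one_disj]; omega
  · simp only [size]; omega
  · simp only [dd_neg, altDepthAux_one_disj]; omega
  · simp only [size]; omega
  · simp only [dd_neg, altDepthAux_one_disj]; omega
  · simp only [size]; omega

/-- Bounded modus ponens `A, ¬A ∨ B ⊢ B` (5 more lines). [Hodel 1995, p. 102 (MP)] [folklore] -/
theorem mpB (h₁ : BD D B ℓ₁ a) (h₂ : BD D B ℓ₂ (disj (neg a) b)) (hb : (neg b).dd ≤ D)
    (hs₁ : a.size + b.size + 1 ≤ B) (hs₂ : 2 * b.size + 2 ≤ B) : BD D B (ℓ₁ + ℓ₂ + 5) b := by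
  have hl₂ := h₂.lineOK
  simp only [LineOK, dd_disj, size] at hl₂
  have h := contrB (cutB (expan'B b h₁ hb hs₁ hs₂) h₂ (by omega))
  exact h.mono (by omega)

/-- Bounded `¬¬`-rule `A ∨ B ⊢ ¬¬A ∨ B` (6 more lines). [Hodel 1995, p. 102] [folklore] -/
theorem negNegB (h : BD D B ℓ (disj a b)) (ha : (neg a).dd ≤ D) (hb : (neg b).dd ≤ D)
    (hs : 2 * (a.size + b.size) + 6 ≤ B) : BD D B (ℓ + 6) (disj (neg (neg a)) b) := by
  have hl := h.lineOK
  simp only [LineOK, dd_disj, size] at hl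
  rw [dd_neg] at ha
  have hax : BD D B 1 (disj (neg (neg a)) (neg a)) :=
    axB (neg a) ⟨by simp only [dd_disj, dd_neg, altDepthAux_one_neg]; omega, by simp only [size]; omega⟩
  have h2 : BD D B (ℓ + (1 + 2) + 1) (disj b (neg (neg a))) :=
    cutB h (commB hax (by simp only [dd_neg, altDepthAux_one_neg]; omega) (by simp only [size]; omega))
      (by simp only [size]; omega)
  exact (commB h2 hb (by omega)).mono (by omega)

/-- Bounded generalized expansion `A ∨ B ⊢ A ∨ (C ∨ B)` (6 more lines).
[Hodel 1995, p. 112 (GEN EXP)] [folklore] -/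
theorem genExpB (c : PropForm ℕ) (h : BD D B ℓ (disj a b)) (ha : (neg a).dd ≤ D)
    (hb : b.dd + 2 ≤ D) (hc : c.dd + 2 ≤ D) (hs : 2 * (a.size + b.size + c.size) + 4 ≤ B) :
    BD D B (ℓ + 6) (disj a (disj c b)) := by
  have hl := h.lineOK
  simp only [LineOK, dd_disj, size] at hl
  refine commB (assocB (expanB c (commB h ha (by omega)) ⟨?_, ?_⟩)) ?_ ?_
  · simp only [dd_disj]; omega
  · simp only [size]; omega
  · simp only [dd_neg, altDepthAux_one_disj]; omega
  · simp only [size]; omega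

/-- Bounded generalized contraction `A ∨ (B ∨ B) ⊢ A ∨ B` (6 more lines).
[Hodel 1995, p. 112 (GEN CTN)] [folklore] -/
theorem genCtnB (h : BD D B ℓ (disj a (disj b b))) (ha : a.dd + 2 ≤ D) (hb : b.dd + 2 ≤ D)
    (hs : 2 * (a.size + 2 * b.size) + 6 ≤ B) : BD D B (ℓ + 6) (disj a b) := by
  have hl := h.lineOK
  simp only [LineOK, dd_disj, size] at hl
  refine contrB (assocB (expanB a (commB (assocB h) ?_ ?_) ⟨?_, ?_⟩))
  · simp only [dd_neg, altDepthAux_one_disj]; omega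
  · simp only [size]; omega
  · simp only [dd_disj]; omega
  · simp only [size]; omega

/-- Bounded removal of a trailing `⊥`: `A ∨ ⊥ ⊢ A` (8 more lines). [folklore] -/
theorem removeBotB (h : BD D B ℓ (disj a (const false))) (ha : (neg a).dd ≤ D)
    (hs : 4 * a.size + 8 ≤ B) : BD D B (ℓ + 8) a := by
  have hl := h.lineOK
  simp only [LineOK, dd_disj, size, dd_const] at hl
  have ha2 := ha
  rw [dd_neg] at ha2
  have hD : 1 ≤ D := by omega
  have hl1 : LineOK D B (disj a (neg (const false))) := by
    constructor
    · simp only [dd_disj, dd_neg, altDepthAux_const']; omega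
    · simp only [size]; omega
  have h1 : BD D B (1 + 1) (disj a (neg (const false))) := expanB a (negBotB hD (by omega)) hl1
  have h2 : BD D B (1 + 1 + 2) (disj (neg (const false)) a) := commB h1 ha (by omega)
  have h3 : BD D B (ℓ + 2) (disj (const false) a) :=
    commB h ha (by omega)
  exact (contrB (cutB h3 h2 (by omega))).mono (by omega)

end TextbookFrege

end Literature.Computability.MetaComplexity

namespace Literature.Computability.MetaComplexity

open Complexity Complexity.PropForm

namespace TextbookFrege

variable {D B : ℕ}

/-! ### Size and depth of list disjunctions -/

/-- Size of a list disjunction, unfolded. [folklore] -/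
@[simp] theorem size_disjList_nil : (disjList []).size = 1 := rfl

/-- Size of a list disjunction, unfolded. [folklore] -/
@[simp] theorem size_disjList_cons (A : PropForm ℕ) (L : List (PropForm ℕ)) :
    (disjList (A :: L)).size = A.size + (disjList L).size + 1 := by
  simp [disjList_cons, size]

/-- Size of the disjunction of a concatenation. [folklore] -/
theorem size_disjList_append (L₁ L₂ : List (PropForm ℕ)) :
    (disjList (L₁ ++ L₂)).size + 1 = (disjList L₁).size + (disjList L₂).size := by
  induction L₁ with
  | nil => simp [size, Nat.add_comm]
  | cons A L₁ ih => simp only [List.cons_append, size_disjList_cons]; omega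

/-- A member is smaller than the list disjunction. [folklore] -/
theorem size_lt_size_disjList {A : PropForm ℕ} {L : List (PropForm ℕ)} (h : A ∈ L) :
    A.size < (disjList L).size := by
  induction L with
  | nil => simp at h
  | cons X L ih =>
    rw [size_disjList_cons]
    rcases List.mem_cons.1 h with rfl | h
    · omega
    · have := ih h; omega

/-- The length of a list is less than the size of its disjunction. [folklore] -/
theorem length_lt_size_disjList (L : List (PropForm ℕ)) : L.length < (disjList L).size := by
  induction L with
  | nil => simp [size]
  | cons A L ih => rw [size_disjList_cons, List.length_cons]; omega

/-- Disjunct depth of a list disjunction is the maximum over the members. [folklore] -/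
theorem dd_disjList_le {L : List (PropForm ℕ)} {p : ℕ} (h : ∀ A ∈ L, A.dd ≤ p) :
    (disjList L).dd ≤ p := by
  induction L with
  | nil => simp
  | cons A L ih =>
    rw [disjList_cons, dd_disj, max_le_iff]
    exact ⟨h A List.mem_cons_self, ih fun X hX => h X (List.mem_cons_of_mem _ hX)⟩

/-- Members are no deeper than the list disjunction. [folklore] -/
theorem dd_le_dd_disjList {A : PropForm ℕ} {L : List (PropForm ℕ)} (h : A ∈ L) :
    A.dd ≤ (disjList L).dd := by
  induction L with
  | nil => simp at h
  | cons X L ih =>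
    rw [disjList_cons, dd_disj]
    rcases List.mem_cons.1 h with rfl | h
    · exact le_max_left _ _
    · exact (ih h).trans (le_max_right _ _)

/-- Negating a list disjunction costs at most two levels of disjunct depth. [folklore] -/
theorem dd_neg_disjList_le {L : List (PropForm ℕ)} {p : ℕ} (h : ∀ A ∈ L, A.dd ≤ p) :
    (neg (disjList L)).dd ≤ p + 2 := by
  cases L with
  | nil => simp
  | cons A L =>
    have h1 := dd_disjList_le h
    rw [disjList_cons, dd_disj] at h1
    rw [disjList_cons, dd_neg, altDepthAux_one_disj]
    omega

/-- The *member sum* `Σ_{A ∈ L} (|A| + 1)` of a list of formulas: `(disjList L).size = msum L + 1`,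
and `msum` is additive and monotone under sublists, which makes size bookkeeping linear.
[folklore] -/
def msum (L : List (PropForm ℕ)) : ℕ :=
  (L.map fun A => A.size + 1).sum

/-- Unfolding `msum`. [folklore] -/
@[simp] theorem msum_nil : msum [] = 0 := rfl

/-- Unfolding `msum`. [folklore] -/
@[simp] theorem msum_cons (A : PropForm ℕ) (L : List (PropForm ℕ)) :
    msum (A :: L) = A.size + 1 + msum L := by
  simp [msum]

/-- `msum` is additive. [folklore] -/
@[simp] theorem msum_append (L₁ L₂ : List (PropForm ℕ)) : msum (L₁ ++ L₂) = msum L₁ + msum L₂ := by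
  simp [msum, List.sum_append]

/-- The size of a list disjunction is its member sum plus one. [folklore] -/
theorem size_disjList_eq_msum (L : List (PropForm ℕ)) : (disjList L).size = msum L + 1 := by
  induction L with
  | nil => simp [size]
  | cons A L ih => rw [size_disjList_cons, msum_cons, ih]; omega

/-- `msum` is monotone under sublists. [folklore] -/
theorem msum_le_of_sublist {L₁ L₂ : List (PropForm ℕ)} (h : L₁.Sublist L₂) : msum L₁ ≤ msum L₂ := by
  induction h with
  | slnil => simp
  | cons A _ ih => rw [msum_cons]; omega
  | cons_cons A _ ih => rw [msum_cons, msum_cons]; omega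

/-- A member is accounted for in the member sum. [folklore] -/
theorem size_lt_msum {A : PropForm ℕ} {L : List (PropForm ℕ)} (h : A ∈ L) : A.size < msum L := by
  have := msum_le_of_sublist (List.singleton_sublist.2 h)
  rw [msum_cons, msum_nil] at this
  omega

/-- The length is at most the member sum. [folklore] -/
theorem length_le_msum (L : List (PropForm ℕ)) : L.length ≤ msum L := by
  induction L with
  | nil => simp
  | cons A L ih => rw [msum_cons, List.length_cons]; omega

variable {ℓ ℓ₁ ℓ₂ m p : ℕ} {A X Y : PropForm ℕ} {L L' L₁ L₂ : List (PropForm ℕ)}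

/-! ### Conjunctions of lists -/

/-- The right-nested conjunction `A₁ ∧ (A₂ ∧ (⋯ ∧ (Aₙ ∧ ⊤)))` of a list of formulas; in
particular `PropForm.ofCNF φ = conjList (φ.map clauseForm)`. [folklore] -/
def conjList (M : List (PropForm ℕ)) : PropForm ℕ :=
  M.foldr conj (const true)

/-- Unfolding `conjList`. [folklore] -/
@[simp] theorem conjList_nil : conjList [] = const true := rfl

/-- Unfolding `conjList`. [folklore] -/
@[simp] theorem conjList_cons (A : PropForm ℕ) (M : List (PropForm ℕ)) :
    conjList (A :: M) = conj A (conjList M) := rfl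

/-- Size of a list conjunction, unfolded. [folklore] -/
@[simp] theorem size_conjList_nil : (conjList []).size = 1 := rfl

/-- Size of a list conjunction, unfolded. [folklore] -/
@[simp] theorem size_conjList_cons (A : PropForm ℕ) (M : List (PropForm ℕ)) :
    (conjList (A :: M)).size = A.size + (conjList M).size + 1 := by
  simp [size]

/-- A member is smaller than the list conjunction. [folklore] -/
theorem size_lt_size_conjList {M : List (PropForm ℕ)} (h : A ∈ M) : A.size < (conjList M).size := by
  induction M with
  | nil => simp at h
  | cons X M ih =>
    rw [size_conjList_cons]
    rcases List.mem_cons.1 h with rfl | h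
    · omega
    · have := ih h; omega

/-- Auxiliary depth (below `∧`) of a list conjunction. [folklore] -/
theorem altDepthAux_two_conjList_le {M : List (PropForm ℕ)} (h : ∀ X ∈ M, X.dd ≤ p) :
    altDepthAux 2 (conjList M) ≤ p + 1 := by
  induction M with
  | nil => simp
  | cons X M ih =>
    have h1 := altDepthAux_le_dd_succ 2 X
    have h2 := h X List.mem_cons_self
    have h3 := ih fun Y hY => h Y (List.mem_cons_of_mem _ hY)
    rw [conjList_cons, altDepthAux_two_conj]
    omega

/-- Disjunct depth of a list conjunction. [folklore] -/
theorem dd_conjList_le {M : List (PropForm ℕ)} (h : ∀ X ∈ M, X.dd ≤ p) :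
    (conjList M).dd ≤ p + 2 := by
  cases M with
  | nil => simp
  | cons X M =>
    have h1 := altDepthAux_two_conjList_le h
    rw [conjList_cons, altDepthAux_two_conj] at h1
    rw [conjList_cons, dd_conj]
    omega

/-- Disjunct depth of a negated list conjunction. [folklore] -/
theorem dd_neg_conjList_le {M : List (PropForm ℕ)} (h : ∀ X ∈ M, X.dd ≤ p) :
    (neg (conjList M)).dd ≤ p + 3 := by
  cases M with
  | nil => simp
  | cons X M =>
    have h1 := altDepthAux_two_conjList_le h
    rw [conjList_cons, altDepthAux_two_conj] at h1
    rw [conjList_cons, dd_neg, altDepthAux_one_conj]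
    omega



/-! ### Axioms and structural rules -/

/-- Bounded sequent axiom `⊢ ¬A, A` (12 lines). [Shoenfield 1967, §2.6] [folklore] -/
theorem axS (A : PropForm ℕ) (hA : A.dd + 4 ≤ D) (hs : 4 * A.size + 8 ≤ B) :
    BD D B 12 (disjList [neg A, A]) := by
  have h1 := altDepthAux_le_dd_succ 1 A
  have hax : BD D B 1 (disj (neg A) A) :=
    axB A ⟨by simp only [dd_disj, dd_neg]; omega, by simp only [size]; omega⟩
  have h2 : BD D B (1 + 3) (disj (disj (neg A) A) (const false)) :=
    expan'B (const false) hax (by simp; omega) (by simp only [size]; omega)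
      (by simp only [size]; omega)
  simpa [disjList] using (assoc'B h2 (by simp only [dd_neg]; omega) (by omega) (by simp; omega)
    (by simp only [size]; omega))

/-- **Member introduction** `⊢ ¬A ∨ ⋁L` for `A ∈ L` (`12 + 6·|L|` lines: the axiom `¬A ∨ A`, the
tail appended by expansion, the members before `A` inserted by generalized expansion).
[Shoenfield 1967, §3.1, Lemma 2] [folklore] -/
theorem memberIntroB (hA : A ∈ L) (hp : ∀ X ∈ L, X.dd ≤ p) (hD : p + 4 ≤ D)
    (hs : 4 * (disjList L).size + 4 ≤ B) :
    BD D B (12 + 6 * L.length) (disj (neg A) (disjList L)) := by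
  obtain ⟨L₁, L₂, rfl⟩ := List.append_of_mem hA
  clear hA
  have h1 := altDepthAux_le_dd_succ 1 A
  induction L₁ with
  | nil =>
    rw [List.nil_append] at hs hp ⊢
    rw [size_disjList_cons] at hs
    rw [disjList_cons, List.length_cons]
    have hpA : A.dd ≤ p := hp A List.mem_cons_self
    have hL₂ : (disjList L₂).dd ≤ p := dd_disjList_le fun X hX => hp X (List.mem_cons_of_mem _ hX)
    have hnL₂ : (neg (disjList L₂)).dd ≤ p + 2 :=
      dd_neg_disjList_le fun X hX => hp X (List.mem_cons_of_mem _ hX)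
    have hax : BD D B 1 (disj (neg A) A) :=
      axB A ⟨by simp only [dd_disj, dd_neg]; omega, by simp only [size]; omega⟩
    have h2 : BD D B (1 + 3) (disj (disj (neg A) A) (disjList L₂)) :=
      expan'B (disjList L₂) hax (by omega) (by simp only [size]; omega) (by omega)
    exact (assoc'B h2 (by simp only [dd_neg]; omega) (by omega) (by omega)
      (by simp only [size]; omega)).mono (by omega)
  | cons X L₁ ih =>
    rw [List.cons_append] at hs hp ⊢
    rw [size_disjList_cons] at hs
    rw [disjList_cons, List.length_cons]
    have hpA : A.dd ≤ p := hp A (List.mem_cons_of_mem _ (List.mem_append_right _ List.mem_cons_self))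
    have hX : X.dd ≤ p := hp X List.mem_cons_self
    have hrest : (disjList (L₁ ++ A :: L₂)).dd ≤ p :=
      dd_disjList_le fun Y hY => hp Y (List.mem_cons_of_mem _ hY)
    have hszA : A.size < (disjList (L₁ ++ A :: L₂)).size :=
      size_lt_size_disjList (List.mem_append_right _ List.mem_cons_self)
    have ih' := ih (fun Y hY => hp Y (List.mem_cons_of_mem _ hY)) (by omega)
    refine (genExpB X ih' (by simp only [dd_neg, altDepthAux_one_neg]; omega) (by omega) (by omega)
      (by simp only [size]; omega)).mono ?_
    simp only [List.length_append, List.length_cons]; omega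

/-- Auxiliary loop of `subsetB`: cut away the members of `L₀ ⊆ L'` one by one from
`⋁L₀ ∨ ⋁L'`, keeping `⋁L'`. [Shoenfield 1967, §3.1, Lemma 2] [folklore] -/
theorem subsetAuxB (L₀ : List (PropForm ℕ)) (hsub : ∀ A ∈ L₀, A ∈ L') (hp : ∀ X ∈ L', X.dd ≤ p)
    (hD : p + 4 ≤ D) (hs : 2 * (disjList L₀).size + 4 * (disjList L').size + 8 ≤ B)
    (h : BD D B ℓ (disj (disjList L₀) (disjList L'))) :
    BD D B (ℓ + L₀.length * (35 + 6 * L'.length)) (disj (const false) (disjList L')) := by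
  induction L₀ generalizing ℓ with
  | nil => simpa using h
  | cons A L₀ ih =>
    have hA : A ∈ L' := hsub A List.mem_cons_self
    have hpA : A.dd ≤ p := hp A hA
    have hZ : (disjList L').dd ≤ p := dd_disjList_le hp
    have hR : (disjList L₀).dd ≤ p :=
      dd_disjList_le fun X hX => hp X (hsub X (List.mem_cons_of_mem _ hX))
    rw [disjList_cons] at h
    rw [size_disjList_cons] at hs
    rw [List.length_cons]
    -- `A ∨ (⋁L₀ ∨ ⋁L')`
    have h1 : BD D B (ℓ + 8) (disj A (disj (disjList L₀) (disjList L'))) :=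
      assoc'B h (by omega) (by omega) (by omega) (by
          omega)
    -- `¬A ∨ ⋁L'`
    have h2 : BD D B (12 + 6 * L'.length) (disj (neg A) (disjList L')) :=
      memberIntroB hA hp hD (by omega)
    -- `(⋁L₀ ∨ ⋁L') ∨ ⋁L'`, then `⋁L₀ ∨ (⋁L' ∨ ⋁L')`, then `⋁L₀ ∨ ⋁L'`
    have h3 : BD D B (ℓ + 8 + (12 + 6 * L'.length) + 1)
        (disj (disj (disjList L₀) (disjList L')) (disjList L')) :=
      cutB h1 h2 (by simp only [size]; omega)
    have h4 : BD D B (ℓ + 8 + (12 + 6 * L'.length) + 1 + 8)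
        (disj (disjList L₀) (disj (disjList L') (disjList L'))) :=
      assoc'B h3 (by omega) (by omega) (by omega) (by
          omega)
    have h5 : BD D B (ℓ + 8 + (12 + 6 * L'.length) + 1 + 8 + 6)
        (disj (disjList L₀) (disjList L')) :=
      genCtnB h4 (by omega) (by omega) (by
          omega)
    have h6 := ih (fun X hX => hsub X (List.mem_cons_of_mem _ hX)) (by omega) h5
    refine h6.mono ?_
    have : L₀.length * (35 + 6 * L'.length) + (35 + 6 * L'.length) =
        (L₀.length + 1) * (35 + 6 * L'.length) := by ring
    omega

/-- **Structural rule** (weakening, exchange, contraction at once): if every member of `L` occurs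
in `L'` then `⋁L ⊢ ⋁L'`, in `13 + |L|·(35 + 6|L'|)` extra lines of linear size.
[Shoenfield 1967, §3.1, Lemma 2] [folklore] -/
theorem subsetB (h : BD D B ℓ (disjList L)) (hsub : ∀ A ∈ L, A ∈ L') (hp : ∀ X ∈ L', X.dd ≤ p)
    (hD : p + 4 ≤ D) (hs : 2 * (disjList L).size + 4 * (disjList L').size + 8 ≤ B) :
    BD D B (ℓ + 13 + L.length * (35 + 6 * L'.length)) (disjList L') := by
  have hZ : (disjList L').dd ≤ p := dd_disjList_le hp
  have hnZ : (neg (disjList L')).dd ≤ p + 2 := dd_neg_disjList_le hp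
  have h1 : BD D B (ℓ + 3) (disj (disjList L) (disjList L')) :=
    expan'B (disjList L') h (by omega) (by omega) (by omega)
  have h2 := subsetAuxB L hsub hp hD hs h1
  have h3 : BD D B (ℓ + 3 + L.length * (35 + 6 * L'.length) + 2)
      (disj (disjList L') (const false)) :=
    commB h2 (by simp; omega) (by simp only [size]; omega)
  exact (removeBotB h3 (by omega) (by omega)).mono (by omega)

/-- **Cut on the head formula**: `⊢ A, L` and `⊢ ¬A, L` give `⊢ L` (2 more lines: cut,
contraction). [Shoenfield 1967, §2.6] [folklore] -/
theorem cutS (h₁ : BD D B ℓ₁ (disjList (A :: L))) (h₂ : BD D B ℓ₂ (disjList (neg A :: L)))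
    (hs : 2 * (disjList L).size + 1 ≤ B) : BD D B (ℓ₁ + ℓ₂ + 2) (disjList L) := by
  rw [disjList_cons] at h₁ h₂
  exact contrB (cutB h₁ h₂ (by omega))

/-! ### Connective rules at the head of a sequent -/

/-- A single formula as a one-element sequent `⊢ A` (3 more lines). [folklore] -/
theorem unitS (h : BD D B ℓ A) (hD : 1 ≤ D) (hs : 2 * A.size + 4 ≤ B) :
    BD D B (ℓ + 3) (disjList [A]) := by
  have := h.lineOK
  simp only [LineOK] at this
  simpa [disjList] using expan'B (const false) h (by
      norm_num only [size, dd_disj, dd_neg, dd_conj, dd_var, dd_const, altDepthAux_one_neg,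
        altDepthAux_two_neg, altDepthAux_one_disj, altDepthAux_two_disj, altDepthAux_one_conj,
        altDepthAux_two_conj, altDepthAux_var', altDepthAux_const', disjList_cons, disjList_nil,
        conjList_cons, conjList_nil] at *
      omega) (by
      norm_num only [size, dd_disj, dd_neg, dd_conj, dd_var, dd_const, altDepthAux_one_neg,
        altDepthAux_two_neg, altDepthAux_one_disj, altDepthAux_two_disj, altDepthAux_one_conj,
        altDepthAux_two_conj, altDepthAux_var', altDepthAux_const', disjList_cons, disjList_nil,
        conjList_cons, conjList_nil] at *
      omega) (by
      norm_num only [size, dd_disj, dd_neg, dd_conj, dd_var, dd_const, altDepthAux_one_neg,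
        altDepthAux_two_neg, altDepthAux_one_disj, altDepthAux_two_disj, altDepthAux_one_conj,
        altDepthAux_two_conj, altDepthAux_var', altDepthAux_const', disjList_cons, disjList_nil,
        conjList_cons, conjList_nil] at *
      omega)

/-- The sequent `⊢ ⊤` (4 lines). [folklore] -/
theorem topS (hD : 1 ≤ D) (hs : 6 ≤ B) : BD D B 4 (disjList [const true]) :=
  unitS (topB (by omega)) hD (by
      norm_num only [size, dd_disj, dd_neg, dd_conj, dd_var, dd_const, altDepthAux_one_neg,
        altDepthAux_two_neg, altDepthAux_one_disj, altDepthAux_two_disj, altDepthAux_one_conj,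
        altDepthAux_two_conj, altDepthAux_var', altDepthAux_const', disjList_cons, disjList_nil,
        conjList_cons, conjList_nil] at *
      omega)

/-- `⋁(X :: Y :: L) ⊢ ⋁((X ∨ Y) :: L)` (1 more line). [Shoenfield 1967, §3.1 (case `∨`)]
[folklore] -/
theorem consDisjS (h : BD D B ℓ (disjList (X :: Y :: L))) :
    BD D B (ℓ + 1) (disjList (disj X Y :: L)) := by
  simp only [disjList_cons] at h ⊢
  exact assocB h

/-- `⋁((X ∨ Y) :: L) ⊢ ⋁(X :: Y :: L)` (8 more lines). [Hodel 1995, p. 102 (new ASSOC)]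
[folklore] -/
theorem flattenS (h : BD D B ℓ (disjList (disj X Y :: L))) (hX : X.dd + 2 ≤ D) (hY : Y.dd + 2 ≤ D)
    (hL : (disjList L).dd + 2 ≤ D) (hs : 2 * (disjList (X :: Y :: L)).size + 4 ≤ B) :
    BD D B (ℓ + 8) (disjList (X :: Y :: L)) := by
  simp only [size_disjList_cons] at hs
  simp only [disjList_cons] at h ⊢
  exact assoc'B h hX hY hL (by
      omega)

/-- `⋁(X :: L) ⊢ ⋁(¬¬X :: L)` (6 more lines). [Shoenfield 1967, §3.1 (case `¬¬`)] [folklore] -/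
theorem consNegNegS (h : BD D B ℓ (disjList (X :: L))) (hX : (neg X).dd ≤ D)
    (hL : (neg (disjList L)).dd ≤ D) (hs : 2 * (disjList (X :: L)).size + 6 ≤ B) :
    BD D B (ℓ + 6) (disjList (neg (neg X) :: L)) := by
  simp only [size_disjList_cons] at hs
  simp only [disjList_cons] at h ⊢
  exact negNegB h hX hL (by omega)

/-- `⋁(¬X :: L), ⋁(¬Y :: L) ⊢ ⋁(¬(X ∨ Y) :: L)` (35 more lines). [Shoenfield 1967, §3.1
(case `¬∨`)] [folklore] -/
theorem consNegDisjS (hB : BD D B ℓ₁ (disjList (neg X :: L))) (hC : BD D B ℓ₂ (disjList (neg Y :: L)))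
    (hX : X.dd + 4 ≤ D) (hY : Y.dd + 4 ≤ D) (hL : (disjList L).dd + 2 ≤ D)
    (hs : 4 * (X.size + Y.size + (disjList L).size) + 16 ≤ B) :
    BD D B (ℓ₁ + ℓ₂ + 35) (disjList (neg (disj X Y) :: L)) := by
  simp only [disjList_cons] at hB hC ⊢
  have hax : BD D B 1 (disj (neg (disj X Y)) (disj X Y)) :=
    axB (disj X Y) ⟨by
        norm_num only [size, dd_disj, dd_neg, dd_conj, dd_var, dd_const, altDepthAux_one_neg,
          altDepthAux_two_neg, altDepthAux_one_disj, altDepthAux_two_disj, altDepthAux_one_conj,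
          altDepthAux_two_conj, altDepthAux_var', altDepthAux_const', disjList_cons, disjList_nil,
          conjList_cons, conjList_nil] at *
        omega, by
        norm_num only [size, dd_disj, dd_neg, dd_conj, dd_var, dd_const, altDepthAux_one_neg,
          altDepthAux_two_neg, altDepthAux_one_disj, altDepthAux_two_disj, altDepthAux_one_conj,
          altDepthAux_two_conj, altDepthAux_var', altDepthAux_const', disjList_cons, disjList_nil,
          conjList_cons, conjList_nil] at *
        omega⟩
  have hc : BD D B (1 + 2) (disj (disj X Y) (neg (disj X Y))) := commB hax (by
      norm_num only [size, dd_disj, dd_neg, dd_conj, dd_var, dd_const, altDepthAux_one_neg,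
        altDepthAux_two_neg, altDepthAux_one_disj, altDepthAux_two_disj, altDepthAux_one_conj,
        altDepthAux_two_conj, altDepthAux_var', altDepthAux_const', disjList_cons, disjList_nil,
        conjList_cons, conjList_nil] at *
      omega) (by
      norm_num only [size, dd_disj, dd_neg, dd_conj, dd_var, dd_const, altDepthAux_one_neg,
        altDepthAux_two_neg, altDepthAux_one_disj, altDepthAux_two_disj, altDepthAux_one_conj,
        altDepthAux_two_conj, altDepthAux_var', altDepthAux_const', disjList_cons, disjList_nil,
        conjList_cons, conjList_nil] at *
      omega)
  have h0 : BD D B (1 + 2 + 8) (disj X (disj Y (neg (disj X Y)))) :=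
    assoc'B hc (by
        norm_num only [size, dd_disj, dd_neg, dd_conj, dd_var, dd_const, altDepthAux_one_neg,
          altDepthAux_two_neg, altDepthAux_one_disj, altDepthAux_two_disj, altDepthAux_one_conj,
          altDepthAux_two_conj, altDepthAux_var', altDepthAux_const', disjList_cons, disjList_nil,
          conjList_cons, conjList_nil] at *
        omega) (by
        norm_num only [size, dd_disj, dd_neg, dd_conj, dd_var, dd_const, altDepthAux_one_neg,
          altDepthAux_two_neg, altDepthAux_one_disj, altDepthAux_two_disj, altDepthAux_one_conj,
          altDepthAux_two_conj, altDepthAux_var', altDepthAux_const', disjList_cons, disjList_nil,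
          conjList_cons, conjList_nil] at *
        omega) (by
        norm_num only [size, dd_disj, dd_neg, dd_conj, dd_var, dd_const, altDepthAux_one_neg,
          altDepthAux_two_neg, altDepthAux_one_disj, altDepthAux_two_disj, altDepthAux_one_conj,
          altDepthAux_two_conj, altDepthAux_var', altDepthAux_const', disjList_cons, disjList_nil,
          conjList_cons, conjList_nil] at *
        omega) (by
        norm_num only [size, dd_disj, dd_neg, dd_conj, dd_var, dd_const, altDepthAux_one_neg,
          altDepthAux_two_neg, altDepthAux_one_disj, altDepthAux_two_disj, altDepthAux_one_conj,
          altDepthAux_two_conj, altDepthAux_var', altDepthAux_const', disjList_cons, disjList_nil,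
          conjList_cons, conjList_nil] at *
        omega)
  have h1 := cutB h0 hB (by
      norm_num only [size, dd_disj, dd_neg, dd_conj, dd_var, dd_const, altDepthAux_one_neg,
        altDepthAux_two_neg, altDepthAux_one_disj, altDepthAux_two_disj, altDepthAux_one_conj,
        altDepthAux_two_conj, altDepthAux_var', altDepthAux_const', disjList_cons, disjList_nil,
        conjList_cons, conjList_nil] at *
      omega)
  have h2 := assoc'B h1 (by
      norm_num only [size, dd_disj, dd_neg, dd_conj, dd_var, dd_const, altDepthAux_one_neg,
        altDepthAux_two_neg, altDepthAux_one_disj, altDepthAux_two_disj, altDepthAux_one_conj,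
        altDepthAux_two_conj, altDepthAux_var', altDepthAux_const', disjList_cons, disjList_nil,
        conjList_cons, conjList_nil] at *
      omega) (by
      norm_num only [size, dd_disj, dd_neg, dd_conj, dd_var, dd_const, altDepthAux_one_neg,
        altDepthAux_two_neg, altDepthAux_one_disj, altDepthAux_two_disj, altDepthAux_one_conj,
        altDepthAux_two_conj, altDepthAux_var', altDepthAux_const', disjList_cons, disjList_nil,
        conjList_cons, conjList_nil] at *
      omega) (by
      norm_num only [size, dd_disj, dd_neg, dd_conj, dd_var, dd_const, altDepthAux_one_neg,
        altDepthAux_two_neg, altDepthAux_one_disj, altDepthAux_two_disj, altDepthAux_one_conj,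
        altDepthAux_two_conj, altDepthAux_var', altDepthAux_const', disjList_cons, disjList_nil,
        conjList_cons, conjList_nil] at *
      omega) (by
      norm_num only [size, dd_disj, dd_neg, dd_conj, dd_var, dd_const, altDepthAux_one_neg,
        altDepthAux_two_neg, altDepthAux_one_disj, altDepthAux_two_disj, altDepthAux_one_conj,
        altDepthAux_two_conj, altDepthAux_var', altDepthAux_const', disjList_cons, disjList_nil,
        conjList_cons, conjList_nil] at *
      omega)
  have h3 := cutB h2 hC (by
      norm_num only [size, dd_disj, dd_neg, dd_conj, dd_var, dd_const, altDepthAux_one_neg,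
        altDepthAux_two_neg, altDepthAux_one_disj, altDepthAux_two_disj, altDepthAux_one_conj,
        altDepthAux_two_conj, altDepthAux_var', altDepthAux_const', disjList_cons, disjList_nil,
        conjList_cons, conjList_nil] at *
      omega)
  have h4 := assoc'B h3 (by
      norm_num only [size, dd_disj, dd_neg, dd_conj, dd_var, dd_const, altDepthAux_one_neg,
        altDepthAux_two_neg, altDepthAux_one_disj, altDepthAux_two_disj, altDepthAux_one_conj,
        altDepthAux_two_conj, altDepthAux_var', altDepthAux_const', disjList_cons, disjList_nil,
        conjList_cons, conjList_nil] at *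
      omega) (by
      norm_num only [size, dd_disj, dd_neg, dd_conj, dd_var, dd_const, altDepthAux_one_neg,
        altDepthAux_two_neg, altDepthAux_one_disj, altDepthAux_two_disj, altDepthAux_one_conj,
        altDepthAux_two_conj, altDepthAux_var', altDepthAux_const', disjList_cons, disjList_nil,
        conjList_cons, conjList_nil] at *
      omega) (by
      norm_num only [size, dd_disj, dd_neg, dd_conj, dd_var, dd_const, altDepthAux_one_neg,
        altDepthAux_two_neg, altDepthAux_one_disj, altDepthAux_two_disj, altDepthAux_one_conj,
        altDepthAux_two_conj, altDepthAux_var', altDepthAux_const', disjList_cons, disjList_nil,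
        conjList_cons, conjList_nil] at *
      omega) (by
      norm_num only [size, dd_disj, dd_neg, dd_conj, dd_var, dd_const, altDepthAux_one_neg,
        altDepthAux_two_neg, altDepthAux_one_disj, altDepthAux_two_disj, altDepthAux_one_conj,
        altDepthAux_two_conj, altDepthAux_var', altDepthAux_const', disjList_cons, disjList_nil,
        conjList_cons, conjList_nil] at *
      omega)
  exact (genCtnB h4 (by
      norm_num only [size, dd_disj, dd_neg, dd_conj, dd_var, dd_const, altDepthAux_one_neg,
        altDepthAux_two_neg, altDepthAux_one_disj, altDepthAux_two_disj, altDepthAux_one_conj,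
        altDepthAux_two_conj, altDepthAux_var', altDepthAux_const', disjList_cons, disjList_nil,
        conjList_cons, conjList_nil] at *
      omega) (by
      norm_num only [size, dd_disj, dd_neg, dd_conj, dd_var, dd_const, altDepthAux_one_neg,
        altDepthAux_two_neg, altDepthAux_one_disj, altDepthAux_two_disj, altDepthAux_one_conj,
        altDepthAux_two_conj, altDepthAux_var', altDepthAux_const', disjList_cons, disjList_nil,
        conjList_cons, conjList_nil] at *
      omega) (by
      norm_num only [size, dd_disj, dd_neg, dd_conj, dd_var, dd_const, altDepthAux_one_neg,
        altDepthAux_two_neg, altDepthAux_one_disj, altDepthAux_two_disj, altDepthAux_one_conj,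
        altDepthAux_two_conj, altDepthAux_var', altDepthAux_const', disjList_cons, disjList_nil,
        conjList_cons, conjList_nil] at *
      omega)).mono (by omega)

/-- `⋁(X :: L), ⋁(Y :: L) ⊢ ⋁((X ∧ Y) :: L)` (51 more lines, via the definitional axiom
`¬¬(¬X ∨ ¬Y) ∨ (X ∧ Y)`). [Hodel 1995, p. 103 (JOIN)] [folklore] -/
theorem consConjS (hB : BD D B ℓ₁ (disjList (X :: L))) (hC : BD D B ℓ₂ (disjList (Y :: L)))
    (hX : X.dd + 6 ≤ D) (hY : Y.dd + 6 ≤ D) (hL : (disjList L).dd + 2 ≤ D)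
    (hs : 4 * (X.size + Y.size + (disjList L).size) + 24 ≤ B) :
    BD D B (ℓ₁ + ℓ₂ + 51) (disjList (conj X Y :: L)) := by
  have hx1 := altDepthAux_le_dd_succ 1 X
  have hy1 := altDepthAux_le_dd_succ 1 Y
  have hx2 := altDepthAux_le_dd_succ 2 X
  have hy2 := altDepthAux_le_dd_succ 2 Y
  have hl1 := altDepthAux_le_dd_succ 1 (disjList L)
  have hB' : BD D B (ℓ₁ + 6) (disjList (neg (neg X) :: L)) :=
    consNegNegS hB (by
        norm_num only [size, dd_disj, dd_neg, dd_conj, dd_var, dd_const, altDepthAux_one_neg,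
          altDepthAux_two_neg, altDepthAux_one_disj, altDepthAux_two_disj, altDepthAux_one_conj,
          altDepthAux_two_conj, altDepthAux_var', altDepthAux_const', disjList_cons, disjList_nil,
          conjList_cons, conjList_nil] at *
        omega) (by
        norm_num only [size, dd_disj, dd_neg, dd_conj, dd_var, dd_const, altDepthAux_one_neg,
          altDepthAux_two_neg, altDepthAux_one_disj, altDepthAux_two_disj, altDepthAux_one_conj,
          altDepthAux_two_conj, altDepthAux_var', altDepthAux_const', disjList_cons, disjList_nil,
          conjList_cons, conjList_nil] at *
        omega) (by
        norm_num only [size, dd_disj, dd_neg, dd_conj, dd_var, dd_const, altDepthAux_one_neg,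
          altDepthAux_two_neg, altDepthAux_one_disj, altDepthAux_two_disj, altDepthAux_one_conj,
          altDepthAux_two_conj, altDepthAux_var', altDepthAux_const', disjList_cons, disjList_nil,
          conjList_cons, conjList_nil] at *
        omega)
  have hC' : BD D B (ℓ₂ + 6) (disjList (neg (neg Y) :: L)) :=
    consNegNegS hC (by
        norm_num only [size, dd_disj, dd_neg, dd_conj, dd_var, dd_const, altDepthAux_one_neg,
          altDepthAux_two_neg, altDepthAux_one_disj, altDepthAux_two_disj, altDepthAux_one_conj,
          altDepthAux_two_conj, altDepthAux_var', altDepthAux_const', disjList_cons, disjList_nil,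
          conjList_cons, conjList_nil] at *
        omega) (by
        norm_num only [size, dd_disj, dd_neg, dd_conj, dd_var, dd_const, altDepthAux_one_neg,
          altDepthAux_two_neg, altDepthAux_one_disj, altDepthAux_two_disj, altDepthAux_one_conj,
          altDepthAux_two_conj, altDepthAux_var', altDepthAux_const', disjList_cons, disjList_nil,
          conjList_cons, conjList_nil] at *
        omega) (by
        norm_num only [size, dd_disj, dd_neg, dd_conj, dd_var, dd_const, altDepthAux_one_neg,
          altDepthAux_two_neg, altDepthAux_one_disj, altDepthAux_two_disj, altDepthAux_one_conj,
          altDepthAux_two_conj, altDepthAux_var', altDepthAux_const', disjList_cons, disjList_nil,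
          conjList_cons, conjList_nil] at *
        omega)
  have hM : BD D B (ℓ₁ + 6 + (ℓ₂ + 6) + 35) (disjList (neg (disj (neg X) (neg Y)) :: L)) :=
    consNegDisjS hB' hC' (by
        norm_num only [size, dd_disj, dd_neg, dd_conj, dd_var, dd_const, altDepthAux_one_neg,
          altDepthAux_two_neg, altDepthAux_one_disj, altDepthAux_two_disj, altDepthAux_one_conj,
          altDepthAux_two_conj, altDepthAux_var', altDepthAux_const', disjList_cons, disjList_nil,
          conjList_cons, conjList_nil] at *
        omega) (by
        norm_num only [size, dd_disj, dd_neg, dd_conj, dd_var, dd_const, altDepthAux_one_neg,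
          altDepthAux_two_neg, altDepthAux_one_disj, altDepthAux_two_disj, altDepthAux_one_conj,
          altDepthAux_two_conj, altDepthAux_var', altDepthAux_const', disjList_cons, disjList_nil,
          conjList_cons, conjList_nil] at *
        omega) hL (by
        norm_num only [size, dd_disj, dd_neg, dd_conj, dd_var, dd_const, altDepthAux_one_neg,
          altDepthAux_two_neg, altDepthAux_one_disj, altDepthAux_two_disj, altDepthAux_one_conj,
          altDepthAux_two_conj, altDepthAux_var', altDepthAux_const', disjList_cons, disjList_nil,
          conjList_cons, conjList_nil] at *
        omega)
  simp only [disjList_cons] at hM ⊢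
  have hax : BD D B 1 (disj (neg (neg (disj (neg X) (neg Y)))) (conj X Y)) :=
    conjAx₂B X Y ⟨by
        norm_num only [size, dd_disj, dd_neg, dd_conj, dd_var, dd_const, altDepthAux_one_neg,
          altDepthAux_two_neg, altDepthAux_one_disj, altDepthAux_two_disj, altDepthAux_one_conj,
          altDepthAux_two_conj, altDepthAux_var', altDepthAux_const', disjList_cons, disjList_nil,
          conjList_cons, conjList_nil] at *
        omega, by
        norm_num only [size, dd_disj, dd_neg, dd_conj, dd_var, dd_const, altDepthAux_one_neg,
          altDepthAux_two_neg, altDepthAux_one_disj, altDepthAux_two_disj, altDepthAux_one_conj,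
          altDepthAux_two_conj, altDepthAux_var', altDepthAux_const', disjList_cons, disjList_nil,
          conjList_cons, conjList_nil] at *
        omega⟩
  have h1 := cutB hM hax (by
      norm_num only [size, dd_disj, dd_neg, dd_conj, dd_var, dd_const, altDepthAux_one_neg,
        altDepthAux_two_neg, altDepthAux_one_disj, altDepthAux_two_disj, altDepthAux_one_conj,
        altDepthAux_two_conj, altDepthAux_var', altDepthAux_const', disjList_cons, disjList_nil,
        conjList_cons, conjList_nil] at *
      omega)
  exact (commB h1 (by
      norm_num only [size, dd_disj, dd_neg, dd_conj, dd_var, dd_const, altDepthAux_one_neg,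
        altDepthAux_two_neg, altDepthAux_one_disj, altDepthAux_two_disj, altDepthAux_one_conj,
        altDepthAux_two_conj, altDepthAux_var', altDepthAux_const', disjList_cons, disjList_nil,
        conjList_cons, conjList_nil] at *
      omega) (by
      norm_num only [size, dd_disj, dd_neg, dd_conj, dd_var, dd_const, altDepthAux_one_neg,
        altDepthAux_two_neg, altDepthAux_one_disj, altDepthAux_two_disj, altDepthAux_one_conj,
        altDepthAux_two_conj, altDepthAux_var', altDepthAux_const', disjList_cons, disjList_nil,
        conjList_cons, conjList_nil] at *
      omega)).mono (by omega)

/-- `⋁(¬X :: ¬Y :: L) ⊢ ⋁(¬(X ∧ Y) :: L)` (7 more lines, via the definitional axiom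
`¬(X ∧ Y) ∨ ¬(¬X ∨ ¬Y)`). [Hodel 1995, p. 103 (Example 2)] [folklore] -/
theorem consNegConjS (h : BD D B ℓ (disjList (neg X :: neg Y :: L))) (hX : X.dd + 4 ≤ D)
    (hY : Y.dd + 4 ≤ D) (hL : (neg (disjList L)).dd ≤ D)
    (hs : 4 * (X.size + Y.size + (disjList L).size) + 16 ≤ B) :
    BD D B (ℓ + 7) (disjList (neg (conj X Y) :: L)) := by
  have hx1 := altDepthAux_le_dd_succ 1 X
  have hy1 := altDepthAux_le_dd_succ 1 Y
  have hx2 := altDepthAux_le_dd_succ 2 X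
  have hy2 := altDepthAux_le_dd_succ 2 Y
  simp only [disjList_cons] at h ⊢
  have h1 : BD D B (ℓ + 1) (disj (disj (neg X) (neg Y)) (disjList L)) := assocB h
  have hax : BD D B 1 (disj (neg (conj X Y)) (neg (disj (neg X) (neg Y)))) :=
    conjAx₁B X Y ⟨by
        norm_num only [size, dd_disj, dd_neg, dd_conj, dd_var, dd_const, altDepthAux_one_neg,
          altDepthAux_two_neg, altDepthAux_one_disj, altDepthAux_two_disj, altDepthAux_one_conj,
          altDepthAux_two_conj, altDepthAux_var', altDepthAux_const', disjList_cons, disjList_nil,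
          conjList_cons, conjList_nil] at *
        omega, by
        norm_num only [size, dd_disj, dd_neg, dd_conj, dd_var, dd_const, altDepthAux_one_neg,
          altDepthAux_two_neg, altDepthAux_one_disj, altDepthAux_two_disj, altDepthAux_one_conj,
          altDepthAux_two_conj, altDepthAux_var', altDepthAux_const', disjList_cons, disjList_nil,
          conjList_cons, conjList_nil] at *
        omega⟩
  have h2 : BD D B (1 + 2) (disj (neg (disj (neg X) (neg Y))) (neg (conj X Y))) :=
    commB hax (by
        norm_num only [size, dd_disj, dd_neg, dd_conj, dd_var, dd_const, altDepthAux_one_neg,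
          altDepthAux_two_neg, altDepthAux_one_disj, altDepthAux_two_disj, altDepthAux_one_conj,
          altDepthAux_two_conj, altDepthAux_var', altDepthAux_const', disjList_cons, disjList_nil,
          conjList_cons, conjList_nil] at *
        omega) (by
        norm_num only [size, dd_disj, dd_neg, dd_conj, dd_var, dd_const, altDepthAux_one_neg,
          altDepthAux_two_neg, altDepthAux_one_disj, altDepthAux_two_disj, altDepthAux_one_conj,
          altDepthAux_two_conj, altDepthAux_var', altDepthAux_const', disjList_cons, disjList_nil,
          conjList_cons, conjList_nil] at *
        omega)
  have h3 := cutB h1 h2 (by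
      norm_num only [size, dd_disj, dd_neg, dd_conj, dd_var, dd_const, altDepthAux_one_neg,
        altDepthAux_two_neg, altDepthAux_one_disj, altDepthAux_two_disj, altDepthAux_one_conj,
        altDepthAux_two_conj, altDepthAux_var', altDepthAux_const', disjList_cons, disjList_nil,
        conjList_cons, conjList_nil] at *
      omega)
  exact (commB h3 hL (by
      norm_num only [size, dd_disj, dd_neg, dd_conj, dd_var, dd_const, altDepthAux_one_neg,
        altDepthAux_two_neg, altDepthAux_one_disj, altDepthAux_two_disj, altDepthAux_one_conj,
        altDepthAux_two_conj, altDepthAux_var', altDepthAux_const', disjList_cons, disjList_nil,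
        conjList_cons, conjList_nil] at *
      omega)).mono (by omega)

/-! ### Iterated rules -/

/-- **Cut away a list of head formulas**: from `⊢ Xs, L` and `⊢ ¬x, K, L` for every `x ∈ Xs`
and every suffix `K` of `Xs`, infer `⊢ L` (`|Xs|·(m+2)` more lines). [folklore] -/
theorem elimAllS (Xs : List (PropForm ℕ)) (h : BD D B ℓ (disjList (Xs ++ L)))
    (hx : ∀ x ∈ Xs, ∀ K, K <:+ Xs → BD D B m (disjList (neg x :: (K ++ L))))
    (hs : 2 * (disjList (Xs ++ L)).size + 1 ≤ B) :
    BD D B (ℓ + Xs.length * (m + 2)) (disjList L) := by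
  induction Xs generalizing ℓ with
  | nil => simpa using h
  | cons x Xs ih =>
    rw [List.cons_append] at h hs
    rw [size_disjList_cons] at hs
    have h1 : BD D B m (disjList (neg x :: (Xs ++ L))) :=
      hx x List.mem_cons_self Xs (List.suffix_cons x Xs)
    have h2 : BD D B (ℓ + m + 2) (disjList (Xs ++ L)) := cutS h h1 (by omega)
    have h3 := ih h2 (fun y hy K hK => hx y (List.mem_cons_of_mem _ hy) K
      (hK.trans (List.suffix_cons x Xs))) (by omega)
    refine h3.mono ?_
    have : (Xs.length + 1) * (m + 2) = Xs.length * (m + 2) + (m + 2) := by ring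
    rw [List.length_cons]; omega

/-- **Negated disjunction of a list**: from `⊢ ¬z, L` for all `z ∈ Z` infer `⊢ ¬⋁Z, L`
(`4 + |Z|·(m + 35)` lines). [Shoenfield 1967, §3.1 (case `¬∨`, iterated)] [folklore] -/
theorem negDisjListS (Z : List (PropForm ℕ)) (hz : ∀ z ∈ Z, BD D B m (disjList (neg z :: L)))
    (hp : ∀ z ∈ Z, z.dd ≤ p) (hL : (disjList L).dd ≤ p) (hD : p + 4 ≤ D)
    (hs : 4 * ((disjList Z).size + (disjList L).size) + 16 ≤ B) :
    BD D B (4 + Z.length * (m + 35)) (disjList (neg (disjList Z) :: L)) := by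
  induction Z with
  | nil =>
    have hl1 := altDepthAux_le_dd_succ 1 (disjList L)
    have hnL : (neg (disjList L)).dd ≤ D := by
      norm_num only [size, dd_disj, dd_neg, dd_conj, dd_var, dd_const, altDepthAux_one_neg,
        altDepthAux_two_neg, altDepthAux_one_disj, altDepthAux_two_disj, altDepthAux_one_conj,
        altDepthAux_two_conj, altDepthAux_var', altDepthAux_const', disjList_cons, disjList_nil,
        conjList_cons, conjList_nil] at *
      omega
    simp only [size_disjList_nil] at hs
    rw [disjList_nil, disjList_cons]
    simpa using expan'B (disjList L) (negBotB (by omega) (by omega)) hnL (by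
        norm_num only [size, dd_disj, dd_neg, dd_conj, dd_var, dd_const, altDepthAux_one_neg,
          altDepthAux_two_neg, altDepthAux_one_disj, altDepthAux_two_disj, altDepthAux_one_conj,
          altDepthAux_two_conj, altDepthAux_var', altDepthAux_const', disjList_cons, disjList_nil,
          conjList_cons, conjList_nil] at *
        omega) (by
        norm_num only [size, dd_disj, dd_neg, dd_conj, dd_var, dd_const, altDepthAux_one_neg,
          altDepthAux_two_neg, altDepthAux_one_disj, altDepthAux_two_disj, altDepthAux_one_conj,
          altDepthAux_two_conj, altDepthAux_var', altDepthAux_const', disjList_cons, disjList_nil,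
          conjList_cons, conjList_nil] at *
        omega)
  | cons z Z ih =>
    rw [size_disjList_cons] at hs
    have hZ : (disjList Z).dd ≤ p := dd_disjList_le fun y hy => hp y (List.mem_cons_of_mem _ hy)
    have hz' : z.dd ≤ p := hp z List.mem_cons_self
    have ih' := ih (fun y hy => hz y (List.mem_cons_of_mem _ hy))
      (fun y hy => hp y (List.mem_cons_of_mem _ hy)) (by omega)
    rw [disjList_cons]
    refine (consNegDisjS (hz z List.mem_cons_self) ih' (by omega) (by omega) (by omega)
      (by omega)).mono ?_
    have : (Z.length + 1) * (m + 35) = Z.length * (m + 35) + (m + 35) := by ring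
    rw [List.length_cons]; omega

/-! ### Conjunct extraction -/

/-- **Conjunct extraction** `⊢ ¬⋀M, A` for `A ∈ M` (`12 + 126·|M|` lines).
[Shoenfield 1967, §3.1] [folklore] -/
theorem conjExtractS {M : List (PropForm ℕ)} (hA : A ∈ M) (hp : ∀ X ∈ M, X.dd ≤ p)
    (hD : p + 7 ≤ D) (hs : 12 * (conjList M).size + 40 ≤ B) :
    BD D B (12 + 126 * M.length) (disjList [neg (conjList M), A]) := by
  induction M with
  | nil => simp at hA
  | cons X M ih =>
    rw [size_conjList_cons] at hs
    have hX : X.dd ≤ p := hp X List.mem_cons_self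
    have hx1 := altDepthAux_le_dd_succ 1 X
    have hM : ∀ Y ∈ M, Y.dd ≤ p := fun Y hY => hp Y (List.mem_cons_of_mem _ hY)
    have hcM := dd_conjList_le hM
    have hncM := dd_neg_conjList_le hM
    have hszA : A.size < (conjList (X :: M)).size := size_lt_size_conjList hA
    rw [size_conjList_cons] at hszA
    have hpA : A.dd ≤ p := hp A hA
    have ha1 := altDepthAux_le_dd_succ 1 A
    rw [conjList_cons, List.length_cons]
    -- the sequent `⊢ ¬X, ¬⋀M, A`, in `12 + 126·|M| + 119` lines
    have key : BD D B (12 + 126 * M.length + 119) (disjList [neg X, neg (conjList M), A]) := by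
      by_cases hAX : A = X
      · subst hAX
        have h0 : BD D B 12 (disjList [neg A, A]) := axS A (by omega) (by omega)
        refine (subsetB (L' := [neg A, neg (conjList M), A]) h0 (by simp) (p := p + 3) ?_
          (by omega) ?_).mono ?_
        · intro Z hZ
          simp only [List.mem_cons, List.not_mem_nil, or_false] at hZ
          rcases hZ with rfl | rfl | rfl
          · norm_num only [size, dd_disj, dd_neg, dd_conj, dd_var, dd_const, altDepthAux_one_neg,
              altDepthAux_two_neg, altDepthAux_one_disj, altDepthAux_two_disj, altDepthAux_one_conj,
              altDepthAux_two_conj, altDepthAux_var', altDepthAux_const', disjList_cons, disjList_nil,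
              conjList_cons, conjList_nil] at *
            omega
          · omega
          · omega
        · norm_num only [size, dd_disj, dd_neg, dd_conj, dd_var, dd_const, altDepthAux_one_neg,
            altDepthAux_two_neg, altDepthAux_one_disj, altDepthAux_two_disj, altDepthAux_one_conj,
            altDepthAux_two_conj, altDepthAux_var', altDepthAux_const', disjList_cons, disjList_nil,
            conjList_cons, conjList_nil] at *
          omega
        · simp
      · have hA' : A ∈ M := (List.mem_cons.1 hA).resolve_left hAX
        have h0 := ih hA' hM (by omega)
        refine (subsetB (L' := [neg X, neg (conjList M), A]) h0 (by simp) (p := p + 3) ?_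
          (by omega) ?_).mono ?_
        · intro Z hZ
          simp only [List.mem_cons, List.not_mem_nil, or_false] at hZ
          rcases hZ with rfl | rfl | rfl
          · norm_num only [size, dd_disj, dd_neg, dd_conj, dd_var, dd_const, altDepthAux_one_neg,
              altDepthAux_two_neg, altDepthAux_one_disj, altDepthAux_two_disj, altDepthAux_one_conj,
              altDepthAux_two_conj, altDepthAux_var', altDepthAux_const', disjList_cons, disjList_nil,
              conjList_cons, conjList_nil] at *
            omega
          · omega
          · omega
        · norm_num only [size, dd_disj, dd_neg, dd_conj, dd_var, dd_const, altDepthAux_one_neg,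
            altDepthAux_two_neg, altDepthAux_one_disj, altDepthAux_two_disj, altDepthAux_one_conj,
            altDepthAux_two_conj, altDepthAux_var', altDepthAux_const', disjList_cons, disjList_nil,
            conjList_cons, conjList_nil] at *
          omega
        · simp
    exact (consNegConjS key (by omega) (by omega) (by
        norm_num only [size, dd_disj, dd_neg, dd_conj, dd_var, dd_const, altDepthAux_one_neg,
          altDepthAux_two_neg, altDepthAux_one_disj, altDepthAux_two_disj, altDepthAux_one_conj,
          altDepthAux_two_conj, altDepthAux_var', altDepthAux_const', disjList_cons, disjList_nil,
          conjList_cons, conjList_nil] at *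
        omega) (by
        norm_num only [size, dd_disj, dd_neg, dd_conj, dd_var, dd_const, altDepthAux_one_neg,
          altDepthAux_two_neg, altDepthAux_one_disj, altDepthAux_two_disj, altDepthAux_one_conj,
          altDepthAux_two_conj, altDepthAux_var', altDepthAux_const', disjList_cons, disjList_nil,
          conjList_cons, conjList_nil] at *
        omega)).mono (by omega)

/-! ### Distributivity -/

/-- **Product rule** (distributing a conjunction over two sequents): from `⊢ Xs, L` and
`⊢ Ys, L` infer `⊢ [x ∧ y | y ∈ Ys, x ∈ Xs], L`. The line count is cubic in a bound `N` on the
lengths involved (each of the `|Xs|·|Ys|` core sequents `⊢ x ∧ y, ¬x, ¬y` is weakened into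
place and cut away). [Shoenfield 1967, §3.1 (tautology theorem, case `∧`, iterated)]
[folklore] -/
theorem productS (Xs Ys : List (PropForm ℕ)) {N : ℕ}
    (hX : BD D B ℓ₁ (disjList (Xs ++ L))) (hY : BD D B ℓ₂ (disjList (Ys ++ L)))
    (hp : ∀ Z ∈ Xs ++ Ys ++ L, Z.dd ≤ p) (hD : p + 8 ≤ D)
    (hN : (Ys.flatMap fun y => Xs.map fun x => conj x y).length + Xs.length + Ys.length +
      L.length + 3 ≤ N)
    (hs : 16 * msum ((Ys.flatMap fun y => Xs.map fun x => conj x y) ++ Xs ++ Ys ++ L) + 80 ≤ B) :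
    BD D B (ℓ₁ + Xs.length * ℓ₂ + 700 * N ^ 3)
      (disjList ((Ys.flatMap fun y => Xs.map fun x => conj x y) ++ L)) := by
  set P := Ys.flatMap fun y => Xs.map fun x => conj x y with hP
  simp only [msum_append] at hs
  -- depth facts
  have hpX : ∀ x ∈ Xs, x.dd ≤ p := fun x hx => hp x (by simp [hx])
  have hpY : ∀ y ∈ Ys, y.dd ≤ p := fun y hy => hp y (by simp [hy])
  have hpL : ∀ Z ∈ L, Z.dd ≤ p := fun Z hZ => hp Z (by simp [hZ])
  have hmemP : ∀ {x y}, x ∈ Xs → y ∈ Ys → conj x y ∈ P := by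
    intro x y hx hy
    rw [hP, List.mem_flatMap]
    exact ⟨y, hy, List.mem_map.2 ⟨x, hx, rfl⟩⟩
  have hpP : ∀ Z ∈ P, Z.dd ≤ p + 2 := by
    intro Z hZ
    rw [hP, List.mem_flatMap] at hZ
    obtain ⟨y, hy, hZ⟩ := hZ
    obtain ⟨x, hx, rfl⟩ := List.mem_map.1 hZ
    have := altDepthAux_le_dd_succ 2 x
    have := altDepthAux_le_dd_succ 2 y
    have := hpX x hx
    have := hpY y hy
    rw [dd_conj]; omega
  -- size facts
  have hszX : ∀ x ∈ Xs, x.size < msum Xs := fun x hx => size_lt_msum hx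
  have hszY : ∀ y ∈ Ys, y.size < msum Ys := fun y hy => size_lt_msum hy
  have hN1 : 1 ≤ N := by omega
  -- Step A: the core sequents `⊢ x ∧ y, ¬x, ¬y`
  have core : ∀ x ∈ Xs, ∀ y ∈ Ys, BD D B 313 (disjList [conj x y, neg x, neg y]) := by
    intro x hx y hy
    have hx' := hpX x hx
    have hy' := hpY y hy
    have h1x := altDepthAux_le_dd_succ 1 x
    have h1y := altDepthAux_le_dd_succ 1 y
    have hsx := hszX x hx
    have hsy := hszY y hy
    have ax1 : BD D B 12 (disjList [neg x, x]) := axS x (by omega) (by omega)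
    have ax2 : BD D B 12 (disjList [neg y, y]) := axS y (by omega) (by omega)
    have hmem : ∀ Z ∈ [x, neg x, neg y] ++ [y, neg x, neg y], Z.dd ≤ p + 2 := by
      intro Z hZ
      simp only [List.mem_append, List.mem_cons, List.not_mem_nil, or_false] at hZ
      rcases hZ with (rfl | rfl | rfl) | (rfl | rfl | rfl)
      · omega
      · norm_num only [size, dd_disj, dd_neg, dd_conj, dd_var, dd_const, altDepthAux_one_neg,
          altDepthAux_two_neg, altDepthAux_one_disj, altDepthAux_two_disj, altDepthAux_one_conj,
          altDepthAux_two_conj, altDepthAux_var', altDepthAux_const', disjList_cons, disjList_nil,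
          conjList_cons, conjList_nil] at *
        omega
      · norm_num only [size, dd_disj, dd_neg, dd_conj, dd_var, dd_const, altDepthAux_one_neg,
          altDepthAux_two_neg, altDepthAux_one_disj, altDepthAux_two_disj, altDepthAux_one_conj,
          altDepthAux_two_conj, altDepthAux_var', altDepthAux_const', disjList_cons, disjList_nil,
          conjList_cons, conjList_nil] at *
        omega
      · omega
      · norm_num only [size, dd_disj, dd_neg, dd_conj, dd_var, dd_const, altDepthAux_one_neg,
          altDepthAux_two_neg, altDepthAux_one_disj, altDepthAux_two_disj, altDepthAux_one_conj,
          altDepthAux_two_conj, altDepthAux_var', altDepthAux_const', disjList_cons, disjList_nil,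
          conjList_cons, conjList_nil] at *
        omega
      · norm_num only [size, dd_disj, dd_neg, dd_conj, dd_var, dd_const, altDepthAux_one_neg,
          altDepthAux_two_neg, altDepthAux_one_disj, altDepthAux_two_disj, altDepthAux_one_conj,
          altDepthAux_two_conj, altDepthAux_var', altDepthAux_const', disjList_cons, disjList_nil,
          conjList_cons, conjList_nil] at *
        omega
    have s1 : BD D B (12 + 13 + 2 * (35 + 6 * 3)) (disjList [x, neg x, neg y]) :=
      subsetB (L' := [x, neg x, neg y]) ax1 (by simp) (p := p + 2)
        (fun Z hZ => hmem Z (List.mem_append_left _ hZ)) (by omega) (by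
            norm_num only [size, dd_disj, dd_neg, dd_conj, dd_var, dd_const, altDepthAux_one_neg,
              altDepthAux_two_neg, altDepthAux_one_disj, altDepthAux_two_disj, altDepthAux_one_conj,
              altDepthAux_two_conj, altDepthAux_var', altDepthAux_const', disjList_cons, disjList_nil,
              conjList_cons, conjList_nil] at *
            omega)
    have s2 : BD D B (12 + 13 + 2 * (35 + 6 * 3)) (disjList [y, neg x, neg y]) :=
      subsetB (L' := [y, neg x, neg y]) ax2 (by simp) (p := p + 2)
        (fun Z hZ => hmem Z (List.mem_append_right _ hZ)) (by omega) (by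
            norm_num only [size, dd_disj, dd_neg, dd_conj, dd_var, dd_const, altDepthAux_one_neg,
              altDepthAux_two_neg, altDepthAux_one_disj, altDepthAux_two_disj, altDepthAux_one_conj,
              altDepthAux_two_conj, altDepthAux_var', altDepthAux_const', disjList_cons, disjList_nil,
              conjList_cons, conjList_nil] at *
            omega)
    exact (consConjS s1 s2 (by omega) (by omega) (by
        norm_num only [size, dd_disj, dd_neg, dd_conj, dd_var, dd_const, altDepthAux_one_neg,
          altDepthAux_two_neg, altDepthAux_one_disj, altDepthAux_two_disj, altDepthAux_one_conj,
          altDepthAux_two_conj, altDepthAux_var', altDepthAux_const', disjList_cons, disjList_nil,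
          conjList_cons, conjList_nil] at *
        omega) (by
        norm_num only [size, dd_disj, dd_neg, dd_conj, dd_var, dd_const, altDepthAux_one_neg,
          altDepthAux_two_neg, altDepthAux_one_disj, altDepthAux_two_disj, altDepthAux_one_conj,
          altDepthAux_two_conj, altDepthAux_var', altDepthAux_const', disjList_cons, disjList_nil,
          conjList_cons, conjList_nil] at *
        omega)).mono (by omega)
  -- Step A': the core sequents weakened into place
  have coreW : ∀ x ∈ Xs, ∀ y ∈ Ys, ∀ K, K <:+ Ys → ∀ K', K' <:+ Xs →
      BD D B (500 * N) (disjList (neg y :: (K ++ (neg x :: (K' ++ (P ++ L)))))) := by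
    intro x hx y hy K hK K' hK'
    have hx' := hpX x hx
    have hy' := hpY y hy
    have h1x := altDepthAux_le_dd_succ 1 x
    have h1y := altDepthAux_le_dd_succ 1 y
    have hsx := hszX x hx
    have hsy := hszY y hy
    have hK1 := msum_le_of_sublist hK.sublist
    have hK2 := msum_le_of_sublist hK'.sublist
    have hK3 := hK.sublist.length_le
    have hK4 := hK'.sublist.length_le
    have hsub : ∀ Z ∈ [conj x y, neg x, neg y], Z ∈ neg y :: (K ++ (neg x :: (K' ++ (P ++ L)))) := by
      intro Z hZ
      simp only [List.mem_cons, List.not_mem_nil, or_false] at hZ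
      rcases hZ with rfl | rfl | rfl
      · simp [hmemP hx hy]
      · simp
      · simp
    have hmem : ∀ Z ∈ neg y :: (K ++ (neg x :: (K' ++ (P ++ L)))), Z.dd ≤ p + 2 := by
      intro Z hZ
      simp only [List.mem_cons, List.mem_append] at hZ
      rcases hZ with rfl | hZ | rfl | hZ | hZ | hZ
      · norm_num only [size, dd_disj, dd_neg, dd_conj, dd_var, dd_const, altDepthAux_one_neg,
          altDepthAux_two_neg, altDepthAux_one_disj, altDepthAux_two_disj, altDepthAux_one_conj,
          altDepthAux_two_conj, altDepthAux_var', altDepthAux_const', disjList_cons, disjList_nil,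
          conjList_cons, conjList_nil] at *
        omega
      · have := hpY Z (hK.sublist.subset hZ); omega
      · norm_num only [size, dd_disj, dd_neg, dd_conj, dd_var, dd_const, altDepthAux_one_neg,
          altDepthAux_two_neg, altDepthAux_one_disj, altDepthAux_two_disj, altDepthAux_one_conj,
          altDepthAux_two_conj, altDepthAux_var', altDepthAux_const', disjList_cons, disjList_nil,
          conjList_cons, conjList_nil] at *
        omega
      · have := hpX Z (hK'.sublist.subset hZ); omega
      · exact hpP Z hZ
      · have := hpL Z hZ; omega
    refine (subsetB (core x hx y hy) hsub (p := p + 2) hmem (by omega) ?_).mono ?_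
    · simp only [size_disjList_eq_msum, msum_cons, msum_append, msum_nil, size]
      omega
    · simp only [List.length_cons, List.length_append, List.length_nil]
      have : 3 * (35 + 6 * (K.length + (K'.length + (P.length + L.length) + 1) + 1)) ≤
          3 * (35 + 6 * N) := by
        apply Nat.mul_le_mul_left; omega
      omega
  -- Step B: `⊢ ¬x, K', P, L` for `x ∈ Xs` and every suffix `K'` of `Xs`
  have stepB : ∀ x ∈ Xs, ∀ K', K' <:+ Xs →
      BD D B (ℓ₂ + 600 * N ^ 2) (disjList (neg x :: (K' ++ (P ++ L)))) := by
    intro x hx K' hK'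
    have hx' := hpX x hx
    have h1x := altDepthAux_le_dd_succ 1 x
    have hsx := hszX x hx
    have hK2 := msum_le_of_sublist hK'.sublist
    have hK4 := hK'.sublist.length_le
    have hsub : ∀ Z ∈ Ys ++ L, Z ∈ Ys ++ (neg x :: (K' ++ (P ++ L))) := by
      intro Z hZ
      simp only [List.mem_append] at hZ ⊢
      rcases hZ with hZ | hZ
      · exact Or.inl hZ
      · exact Or.inr (List.mem_cons_of_mem _ (by simp [hZ]))
    have hmem : ∀ Z ∈ Ys ++ (neg x :: (K' ++ (P ++ L))), Z.dd ≤ p + 2 := by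
      intro Z hZ
      simp only [List.mem_cons, List.mem_append] at hZ
      rcases hZ with hZ | rfl | hZ | hZ | hZ
      · have := hpY Z hZ; omega
      · norm_num only [size, dd_disj, dd_neg, dd_conj, dd_var, dd_const, altDepthAux_one_neg,
          altDepthAux_two_neg, altDepthAux_one_disj, altDepthAux_two_disj, altDepthAux_one_conj,
          altDepthAux_two_conj, altDepthAux_var', altDepthAux_const', disjList_cons, disjList_nil,
          conjList_cons, conjList_nil] at *
        omega
      · have := hpX Z (hK'.sublist.subset hZ); omega
      · exact hpP Z hZ
      · have := hpL Z hZ; omega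
    have w : BD D B (ℓ₂ + 13 + (Ys ++ L).length *
        (35 + 6 * (Ys ++ (neg x :: (K' ++ (P ++ L)))).length))
        (disjList (Ys ++ (neg x :: (K' ++ (P ++ L))))) := by
      refine subsetB hY hsub (p := p + 2) hmem (by omega) ?_
      simp only [size_disjList_eq_msum, msum_cons, msum_append, size]
      omega
    have e := elimAllS Ys w (fun y hy K hK => coreW x hx y hy K hK K' hK') (by
      simp only [size_disjList_eq_msum, msum_cons, msum_append, size]; omega)
    refine e.mono ?_
    simp only [List.length_append, List.length_cons]
    have h1 : (Ys.length + L.length) *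
        (35 + 6 * (Ys.length + (K'.length + (P.length + L.length) + 1))) ≤ N * (41 * N) :=
      Nat.mul_le_mul (by omega) (by omega)
    have h2 : Ys.length * (500 * N + 2) ≤ N * (502 * N) := Nat.mul_le_mul (by omega) (by omega)
    have h3 : N * (41 * N) + N * (502 * N) + 13 ≤ 600 * N ^ 2 := by rw [pow_two]; nlinarith
    omega
  -- Step C: cut away `Xs`
  have hsub : ∀ Z ∈ Xs ++ L, Z ∈ Xs ++ (P ++ L) := by
    intro Z hZ
    simp only [List.mem_append] at hZ ⊢
    rcases hZ with hZ | hZ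
    · exact Or.inl hZ
    · exact Or.inr (Or.inr hZ)
  have hmem : ∀ Z ∈ Xs ++ (P ++ L), Z.dd ≤ p + 2 := by
    intro Z hZ
    simp only [List.mem_append] at hZ
    rcases hZ with hZ | hZ | hZ
    · have := hpX Z hZ; omega
    · exact hpP Z hZ
    · have := hpL Z hZ; omega
  have w2 : BD D B (ℓ₁ + 13 + (Xs ++ L).length * (35 + 6 * (Xs ++ (P ++ L)).length))
      (disjList (Xs ++ (P ++ L))) := by
    refine subsetB hX hsub (p := p + 2) hmem (by omega) ?_
    simp only [size_disjList_eq_msum, msum_append]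
    omega
  have e2 := elimAllS Xs w2 (fun x hx K' hK' => stepB x hx K' hK') (by
    simp only [size_disjList_eq_msum, msum_append]; omega)
  refine e2.mono ?_
  simp only [List.length_append]
  have h1 : (Xs.length + L.length) * (35 + 6 * (Xs.length + (P.length + L.length))) ≤
      N * (41 * N) := Nat.mul_le_mul (by omega) (by omega)
  have h2 : Xs.length * (ℓ₂ + 600 * N ^ 2 + 2) =
      Xs.length * ℓ₂ + Xs.length * (600 * N ^ 2 + 2) := by ring
  have h3 : Xs.length * (600 * N ^ 2 + 2) ≤ N * (602 * N ^ 2) :=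
    Nat.mul_le_mul (by omega) (by nlinarith)
  have h4 : 13 + N * (41 * N) + N * (602 * N ^ 2) ≤ 700 * N ^ 3 := by nlinarith
  omega

end TextbookFrege

end Literature.Computability.MetaComplexity
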